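import Summits.QuantumFields.YangMills.Theses.SquareRootCeilings

/-!
# Route `SquareRootCeilings` (ym-idea-11 g3, rev 1 split): the split glue is modus ponens

Item stmt-QuantumFields-26793 `SubOnsetTwoPointCeilingsGlue = AxisMirrorCeiling → MirrorDomination →
SubOnsetTwoPointCeilings` with `MirrorDomination = AxisMirrorCeiling → SubOnsetTwoPointCeilings`: the glue of the
split `SubOnsetTwoPointCeilings ⇐ AxisMirrorCeiling ∧ MirrorDomination` is application.  The content of the split lives
in the two children (the on-axis mirror-pair ceiling and the reflection-positivity domination step); nothing else is
proved here — no crux, leg, leaf or summit.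
-/

set_option autoImplicit false

namespace Summit.QuantumFields.YangMills.Theses.SquareRootCeilings

/-- item stmt-QuantumFields-26793 (`SubOnsetTwoPointCeilingsGlue`) of route `SquareRootCeilings`. -/
theorem subOnsetTwoPointCeilingsGlue_proof : SubOnsetTwoPointCeilingsGlue :=
  fun h₁ h₂ => h₂ h₁

end Summit.QuantumFields.YangMills.Theses.SquareRootCeilings
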